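import Literature.NumberTheory.EllipticCurves.ZpExtensionEisensteinLocalUnramifiedReadoutProofs
import HarnessLib

/-!
# The readout of Howard's UNRAMIFIED conditions at `v ∤ p` is unramified over `K_∞`
# (proofs file, part 2 of the `v ∤ p` clause)

Topic `NumberTheory/EllipticCurves` (cell `pub/bsd-print-x9`, blueprint HOME/p2/S1-DISCRETE-CONTROL §2 «v ∤ p»; sequel to
`ZpExtensionEisensteinLocalUnramifiedReadoutProofs` (unramified cores read out to coboundaries on the inertia elements over
`K_∞`; descent of the saturation exponent) and `ZpExtensionEisensteinTowerReadoutBijectiveProofs` (the readout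
`H¹(K, A_𝔮) → H¹(K_∞, E[p^∞])`)). THEOREMS ONLY; no definition, no named fact, no instance, no `sorry`.

For `E = W_K`, `H = ker κ = Gal(K̄/K_∞)`, a finite place `v` and a class `c ∈ H¹(K, T^{(k)})`
(`T^{(k)} = E[p^{k+1}] ⊗ A_{m,k+1}(ψ⁻¹)`):

* `WeierstrassCurve.eisensteinTowerReadout_resH1Hom_inertiaInToH_eq_zero_of_exists` — if the localisation of `c` at `v` has
  a cocycle whose readout is a coboundary on the inertia elements restricting into `H` (the currency of part 1), the readout of
  `[c] ∈ H¹(K, A_𝔮)` in `H¹(K_∞, E[p^∞])` DIES ON `H ⊓ I_v`: its image under `resH1Hom (inertiaInToH H v) id` (restriction to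
  the inertia group of `K_∞` at the place above `v`) vanishes — i.e. it is UNRAMIFIED over `K_∞` at that place
  (Greenberg–Vatsal's condition `[σ|_{I_η}] = 0`);
* **`WeierstrassCurve.eisensteinTowerReadout_resH1Hom_inertiaInToH_eq_zero_of_mem_levelCondition`** — the case of Howard's
  `F_𝔮` at `v ∈ S`, `v ∤ p` (level condition of the saturated tower of UNRAMIFIED cores, `eisensteinSelmerStructure_inr_of_mem_of_not_mem`);
* **`WeierstrassCurve.eisensteinTowerReadout_resH1Hom_inertiaInToH_eq_zero_of_mem_unramifiedSubgroup`** — the case of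
  `F_𝔮` at `v ∉ S ∪ {v ∣ p}` (the unramified classes, `eisensteinSelmerStructure_inr_of_not_mem`).

Combined with "unramified = locally trivial over `K_∞` at a place unramified and finitely decomposed in `K_∞/K`"
(Greenberg–Vatsal, §2 p. 17: `G_η/I_η` is pro-prime-to-`p`; in the tree under `Summits/…/UnramifiedAwayBadPlaces`) this is the
`v ∤ p`, finitely-decomposed clause of binder (B4) of the discrete half of the shared μ-crux's `stub_controlGlue`.

References: [Howard2004HeegnerKolyvagin] Def. 3.1.2, Def. 2.1.1, Def. 2.1.10, Lemma 2.2.7 / Prop. 2.2.8;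
[GreenbergVatsal2000] §2 p. 17; [GreenbergLNM1716] §2 pp. 69–72. BSD is not proved by any of this.
-/

noncomputable section

open scoped Classical ContRepresentation

open NumberField IsDedekindDomain Field
open Literature.NumberTheory.EllipticCurves Literature.NumberTheory.GaloisRepresentations
open Literature.NumberTheory.GaloisRepresentations.galoisCohomology
open Literature.NumberTheory.GaloisCohomology.Howard2004
open Literature.NumberTheory.EllipticCurves.GreenbergSelmer
open IwasawaAlgebra IwasawaAlgebra.EisensteinCoeff

namespace WeierstrassCurve

open Literature.NumberTheory.EllipticCurves.ZpExtension (EisensteinLevel)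

variable {K : Type} [Field K] [NumberField K] (W : WeierstrassCurve ℚ) [W.IsElliptic] {p : ℕ} [hp : Fact p.Prime]
  (κ : ZpExtension K p) {m : ℕ} (hm : 1 ≤ m)

variable (π : IwasawaAlgebra p ⧸ Ideal.span {(PowerSeries.X ^ m + PowerSeries.C (p : ℤ_[p]) : IwasawaAlgebra p)})
  (e : ℕ → ℕ)
  (hkill : letI := IwasawaAlgebra.isLocalRing_quotient_X_pow_add_C p hm
    ∀ k, ∀ r ∈ IsLocalRing.maximalIdeal
      (IwasawaAlgebra p ⧸ Ideal.span {(PowerSeries.X ^ m + PowerSeries.C (p : ℤ_[p]) : IwasawaAlgebra p)}) ^ e k,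
      ∀ x : EisensteinLevel p m (fun j ↦ geomTorsion (W.baseChange K) ((p : ℤ) ^ j)) (k + 1), r • x = 0)
  (hker : letI := IwasawaAlgebra.isLocalRing_quotient_X_pow_add_C p hm
    ∀ k, LinearMap.ker ((W.eisensteinTower (κ.unitTwist (-1)) hm).red k) =
      (IsLocalRing.maximalIdeal
        (IwasawaAlgebra p ⧸ Ideal.span {(PowerSeries.X ^ m + PowerSeries.C (p : ℤ_[p]) : IwasawaAlgebra p)}) ^ e k) •
        (⊤ : Submodule (IwasawaAlgebra p ⧸ Ideal.span {(PowerSeries.X ^ m + PowerSeries.C (p : ℤ_[p]) : IwasawaAlgebra p)})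
          (EisensteinLevel p m (fun j ↦ geomTorsion (W.baseChange K) ((p : ℤ) ^ j)) (k + 1 + 1))))
  (hπ : letI := IwasawaAlgebra.isLocalRing_quotient_X_pow_add_C p hm
    π ∈ IsLocalRing.maximalIdeal
      (IwasawaAlgebra p ⧸ Ideal.span {(PowerSeries.X ^ m + PowerSeries.C (p : ℤ_[p]) : IwasawaAlgebra p)}))
  (he : ∀ k, e k ≤ e (k + 1))
  (hπX : π = Ideal.Quotient.mk _ PowerSeries.X) (hek : ∀ k, e (k + 1) - e k = m)

set_option maxHeartbeats 800000 in
/-- **The readout of a class whose localisation reads out to a coboundary on the inertia elements is UNRAMIFIED over `K_∞`.**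
For `[ξ] ∈ H¹(K, T^{(k)})`: if `loc_v [ξ]` has a cocycle `η` and a point `w ∈ E[p^∞]` with `ι(λ(η τ)) = res τ • w − w` for all
`τ ∈ I_{K_v}` restricting into `ker κ`, then the readout of `[ξ]` in `H¹(K_∞, E[p^∞])` restricts to `0` in `H¹(H ⊓ I_v, E[p^∞])`
(`η − ξ∘res = ∂u`; the readout class is the class of the last coordinate cocycle; principal criterion on `H ⊓ I_v = res(I_{K_v}) ∩ H`).
[cite: Howard2004HeegnerKolyvagin, Def. 2.1.10 and Lemma 2.2.7 / Prop. 2.2.8] [cite: GreenbergVatsal2000, §2 p. 17 ([σ|_{I_η}] = 0)] -/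
theorem eisensteinTowerReadout_resH1Hom_inertiaInToH_eq_zero_of_exists (v : HeightOneSpectrum (𝓞 K)) (k : ℕ)
    (ξ : contOneCocycles
      ((κ.unitTwist (-1)).eisensteinTwist ((W.baseChange K).torsionGaloisModule ((p : ℤ) ^ (k + 1))) hm (k + 1)).toTopRep)
    (hξ : ∃ η : contOneCocycles
        (((κ.unitTwist (-1)).eisensteinTwist ((W.baseChange K).torsionGaloisModule ((p : ℤ) ^ (k + 1))) hm
          (k + 1)).toLocal (Sum.inr v : Place K)).toTopRep,
      oneCocycleClass _ η = galoisCohomology.localization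
        ((κ.unitTwist (-1)).eisensteinTwist ((W.baseChange K).torsionGaloisModule ((p : ℤ) ^ (k + 1))) hm (k + 1))
        (Sum.inr v) 1 (oneCocycleClass _ ξ) ∧
      ∃ w : (W.baseChange K).geomPrimaryTorsion p, ∀ σ : absoluteGaloisGroup (v.adicCompletion K),
        σ ∈ absInertia (v.adicCompletion K) → absGaloisRestrict K (v.adicCompletion K) σ ∈ κ.kerSubgroup →
          AddSubgroup.inclusion (AcSigned.geomTorsion_zpow_le_geomPrimaryTorsion (W.baseChange K) p (k + 1))
              (Twisted.tailReadout p hm (k + 1) ((W.baseChange K).geomTorsion_pow_nsmul_eq_zero p (k + 1)) (η.1 σ)) =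
            absGaloisRestrict K (v.adicCompletion K) σ • w - w) :
    letI := IwasawaAlgebra.isLocalRing_quotient_X_pow_add_C p hm
    resH1Hom (inertiaInToH κ.kerSubgroup v) (AddMonoidHom.id ((W.baseChange K).geomPrimaryTorsion p)) (fun _ _ ↦ rfl)
      (W.eisensteinTowerReadout κ hm π e hkill hker hπ he hπX hek
        (AddCommGroup.DirectLimit.of _ _ k
          (oneCocycleClass ((κ.unitTwist (-1)).eisensteinTwist
            ((W.baseChange K).torsionGaloisModule ((p : ℤ) ^ (k + 1))) hm (k + 1)).toTopRep ξ :
            galoisCohomology ((κ.unitTwist (-1)).eisensteinTwist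
              ((W.baseChange K).torsionGaloisModule ((p : ℤ) ^ (k + 1))) hm (k + 1)) 1) :
          AdicTower.H1A (W.eisensteinTower (κ.unitTwist (-1)) hm) π e hkill hker hπ he)) = 0 := by
  letI := IwasawaAlgebra.isLocalRing_quotient_X_pow_add_C p hm
  obtain ⟨η, hη, w, hw⟩ := hξ
  -- (1) compare `η` with the localised cocycle `ξ ∘ res`: `η - ξ∘res = ∂u`
  obtain ⟨ξres, hξres, hξval⟩ : ∃ ξres : contOneCocycles
      (((κ.unitTwist (-1)).eisensteinTwist ((W.baseChange K).torsionGaloisModule ((p : ℤ) ^ (k + 1))) hm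
        (k + 1)).toLocal (Sum.inr v : Place K)).toTopRep,
      oneCocycleClass _ ξres = galoisCohomology.localization
        ((κ.unitTwist (-1)).eisensteinTwist ((W.baseChange K).torsionGaloisModule ((p : ℤ) ^ (k + 1))) hm (k + 1))
        (Sum.inr v) 1 (oneCocycleClass _ ξ) ∧
      ∀ τ : absoluteGaloisGroup (v.adicCompletion K), ξres.1 τ = ξ.1 (absGaloisRestrict K (v.adicCompletion K) τ) :=
    ⟨contOneCocycles.pullback (absGaloisRestrict K (Place.Completion (Sum.inr v : Place K)))
      (X := ((κ.unitTwist (-1)).eisensteinTwist ((W.baseChange K).torsionGaloisModule ((p : ℤ) ^ (k + 1))) hm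
        (k + 1)).toTopRep)
      (Y := (((κ.unitTwist (-1)).eisensteinTwist ((W.baseChange K).torsionGaloisModule ((p : ℤ) ^ (k + 1))) hm
        (k + 1)).toLocal (Sum.inr v : Place K)).toTopRep)
      (TopRep.ofHom ⟨ContinuousLinearMap.id ℤ _, fun _ ↦ rfl⟩) ξ,
     (galoisCohomology.pullback_one_oneCocycleClass _ _ ξ).symm, fun _ ↦ rfl⟩
  rw [← hξres, ← sub_eq_zero, ← oneCocycleClass_sub, oneCocycleClass_eq_zero_iff] at hη
  obtain ⟨u, hu⟩ := hη
  have key : ∀ τ : absoluteGaloisGroup (v.adicCompletion K), τ ∈ absInertia (v.adicCompletion K) →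
      absGaloisRestrict K (v.adicCompletion K) τ ∈ κ.kerSubgroup →
      AddSubgroup.inclusion (AcSigned.geomTorsion_zpow_le_geomPrimaryTorsion (W.baseChange K) p (k + 1))
          (Twisted.tailReadout p hm (k + 1) ((W.baseChange K).geomTorsion_pow_nsmul_eq_zero p (k + 1))
            (ξ.1 (absGaloisRestrict K (v.adicCompletion K) τ))) =
        absGaloisRestrict K (v.adicCompletion K) τ •
            (w - AddSubgroup.inclusion (AcSigned.geomTorsion_zpow_le_geomPrimaryTorsion (W.baseChange K) p (k + 1))
              (Twisted.tailReadout p hm (k + 1) ((W.baseChange K).geomTorsion_pow_nsmul_eq_zero p (k + 1)) u)) -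
          (w - AddSubgroup.inclusion (AcSigned.geomTorsion_zpow_le_geomPrimaryTorsion (W.baseChange K) p (k + 1))
            (Twisted.tailReadout p hm (k + 1) ((W.baseChange K).geomTorsion_pow_nsmul_eq_zero p (k + 1)) u)) := by
    intro τ hτI hτ
    have h1 : ξ.1 (absGaloisRestrict K (v.adicCompletion K) τ) = η.1 τ -
        (GaloisRep.toLocal v ((κ.unitTwist (-1)).eisensteinTwist
          ((W.baseChange K).torsionGaloisModule ((p : ℤ) ^ (k + 1))) hm (k + 1)) τ u - u) := by
      have h := hu τ
      change η.1 τ - ξres.1 τ = GaloisRep.toLocal v ((κ.unitTwist (-1)).eisensteinTwist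
        ((W.baseChange K).torsionGaloisModule ((p : ℤ) ^ (k + 1))) hm (k + 1)) τ u - u at h
      rw [hξval] at h
      rw [← h, sub_sub_cancel]
    rw [h1, map_sub, map_sub, map_sub, map_sub,
      (W.baseChange K).tailReadout_toLocal_apply_of_mem_kerSubgroup κ hm v (k + 1) hτ]
    rw [show ∀ (b : geomTorsion (W.baseChange K) ((p : ℤ) ^ (k + 1))) (g : absoluteGaloisGroup K),
        AddSubgroup.inclusion (AcSigned.geomTorsion_zpow_le_geomPrimaryTorsion (W.baseChange K) p (k + 1)) (g • b) =
          g • AddSubgroup.inclusion (AcSigned.geomTorsion_zpow_le_geomPrimaryTorsion (W.baseChange K) p (k + 1)) b from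
        fun _ _ ↦ rfl, hw τ hτI hτ, smul_sub]
    abel
  -- (2) the readout class on explicit cocycles, and the principal criterion on `H ⊓ I_v`
  obtain ⟨φ, hφ⟩ := (κ.unitTwist (-1)).exists_coordCocycles hm (k + 1)
    ((κ.unitTwist (-1)).eisensteinTwistChar hm (k + 1)) ((W.baseChange K).torsionGaloisModule ((p : ℤ) ^ (k + 1)))
    (fun σ y ↦ (κ.unitTwist (-1)).eisensteinTwist_torsionGaloisModule_apply hm (k + 1) (W.baseChange K) _ σ y) κ
    (fun b ↦ (W.baseChange K).geomTorsion_pow_nsmul_eq_zero p (k + 1) b)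
    (fun _ hσ ↦ κ.eisensteinTwistChar_unitTwist_eq_one_of_mem_kerSubgroup hm (k + 1) (-1) hσ) ξ
  have hlast : m - 1 < m := Nat.sub_lt (lt_of_lt_of_le zero_lt_one hm) zero_lt_one
  rw [WeierstrassCurve.eisensteinTowerReadout, ZpExtension.eisensteinTowerReadout_of,
    ZpExtension.eisensteinTowerLevelMap_apply, map_zsmul,
    (κ.unitTwist (-1)).eisensteinTwistLevelReadout_oneCocycleClass hm (k + 1) _ _ _ κ _ _ ξ φ hφ, resH1Hom_oneCocycleClass,
    (CocycleCriteria.resH1Hom_oneCocycleClass_eq_zero_iff _ _ _ _).2, zsmul_zero]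
  refine ⟨w - AddSubgroup.inclusion (AcSigned.geomTorsion_zpow_le_geomPrimaryTorsion (W.baseChange K) p (k + 1))
      (Twisted.tailReadout p hm (k + 1) ((W.baseChange K).geomTorsion_pow_nsmul_eq_zero p (k + 1)) u), fun y ↦ ?_⟩
  -- `y ∈ H ⊓ I_v` is `res τ` with `τ ∈ I_{K_v}` and `res τ ∈ ker κ`
  obtain ⟨τ, hτI, hτ⟩ := Subgroup.mem_map.1 ((mem_inertiaIn_iff κ.kerSubgroup v _).1 y.2).2
  have hτ' : absGaloisRestrict K (v.adicCompletion K) τ =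
      (((y : inertiaIn κ.kerSubgroup v) : decomp (K := K) v) : absoluteGaloisGroup K) := hτ
  have hτker : absGaloisRestrict K (v.adicCompletion K) τ ∈ κ.kerSubgroup := by
    rw [hτ']; exact ((mem_inertiaIn_iff κ.kerSubgroup v _).1 y.2).1
  have hval : ((inertiaInToH κ.kerSubgroup v y : κ.kerSubgroup) : absoluteGaloisGroup K) =
      absGaloisRestrict K (v.adicCompletion K) τ := hτ'.symm
  rw [pullback_resHomOfEquivariant_apply, AddMonoidHom.id_apply]
  change AddSubgroup.inclusion _ ((φ ⟨m - 1, hlast⟩).1 (inertiaInToH κ.kerSubgroup v y)) = _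
  rw [hφ, ← ZpExtension.tailReadout_eq_tailReadout_dualFamily_last_smul hm (k + 1)
    ((W.baseChange K).geomTorsion_pow_nsmul_eq_zero p (k + 1)), hval,
    show ∀ n : (W.baseChange K).geomPrimaryTorsion p, y • n = absGaloisRestrict K (v.adicCompletion K) τ • n from
      fun n ↦ by rw [hτ']; rfl]
  exact key τ hτI hτker

/-- **(B4) at `v ∈ S`, `v ∤ p`: the readout of Howard's saturated-unramified condition is unramified over `K_∞`.** For a class
`c ∈ H¹(K, T^{(k)})` whose localisation at `v` lies in the level condition of the saturated tower of UNRAMIFIED cores (`F_𝔮` at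
`v ∈ S`, `v ∤ p`), the readout of `[c]` in `H¹(K_∞, E[p^∞])` restricts to `0` in `H¹(H ⊓ I_v, E[p^∞])` (descend the saturation
exponent along the compatible family, part 1, then `…_of_exists`). [cite: Howard2004HeegnerKolyvagin, Def. 3.1.2 (H¹_unr at v ∈ S, propagated) and Lemma 2.2.7 / Prop. 2.2.8]
[cite: GreenbergVatsal2000, §2 p. 17] -/
theorem eisensteinTowerReadout_resH1Hom_inertiaInToH_eq_zero_of_mem_levelCondition (v : HeightOneSpectrum (𝓞 K)) (k : ℕ)
    (c : galoisCohomology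
      ((κ.unitTwist (-1)).eisensteinTwist ((W.baseChange K).torsionGaloisModule ((p : ℤ) ^ (k + 1))) hm (k + 1)) 1)
    (hc : galoisCohomology.localization
        ((κ.unitTwist (-1)).eisensteinTwist ((W.baseChange K).torsionGaloisModule ((p : ℤ) ^ (k + 1))) hm (k + 1))
        (Sum.inr v) 1 c ∈
      Tower.levelCondition
        ((κ.unitTwist (-1)).eisensteinLocalReduce (fun i ↦ (W.baseChange K).torsionGaloisModule ((p : ℤ) ^ i))
          (fun i ↦ (W.baseChange K).torsionGaloisModuleReduce p i) hm (Sum.inr v)) p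
        (fun j ↦ DiscreteGaloisModule.unramifiedSubgroup (GaloisRep.toLocal v
          ((κ.unitTwist (-1)).eisensteinTwist ((W.baseChange K).torsionGaloisModule ((p : ℤ) ^ j)) hm j)) 1) (k + 1)) :
    letI := IwasawaAlgebra.isLocalRing_quotient_X_pow_add_C p hm
    resH1Hom (inertiaInToH κ.kerSubgroup v) (AddMonoidHom.id ((W.baseChange K).geomPrimaryTorsion p)) (fun _ _ ↦ rfl)
      (W.eisensteinTowerReadout κ hm π e hkill hker hπ he hπX hek
        (AddCommGroup.DirectLimit.of _ _ k c :
          AdicTower.H1A (W.eisensteinTower (κ.unitTwist (-1)) hm) π e hkill hker hπ he)) = 0 := by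
  -- the saturated compatible local family through `loc c`; the top class lies in the unramified core; descend
  obtain ⟨x, hx, hxk⟩ := (Tower.mem_levelCondition_iff _ p _ (k + 1) _).1 hc
  obtain ⟨hcompat, a, ha⟩ := (Tower.mem_saturatedFamilies_iff _ p _ x).1 hx
  have htop := (W.baseChange K).exists_cocycle_eq_coboundary_of_mem_unramifiedSubgroup κ hm v (k + 1 + a)
    (p ^ a • x (k + 1 + a)) (ha (k + 1 + a))
  have hdesc := (W.baseChange K).exists_cocycle_eq_coboundary_of_compatible κ hm v a (k + 1) x hcompat htop
  obtain ⟨ξ, rfl⟩ := oneCocycleClass_surjective _ c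
  rw [hxk] at hdesc
  exact W.eisensteinTowerReadout_resH1Hom_inertiaInToH_eq_zero_of_exists κ hm π e hkill hker hπ he hπX hek v k ξ hdesc

/-- **(B4) at `v ∉ S ∪ {v ∣ p}`: the readout of the unramified condition is unramified over `K_∞`.** For a class
`c ∈ H¹(K, T^{(k)})` whose localisation at `v` is unramified (`F_𝔮` outside `Σ(F) ∪ {v ∣ p}`), the readout of `[c]` in
`H¹(K_∞, E[p^∞])` restricts to `0` in `H¹(H ⊓ I_v, E[p^∞])`. [cite: Howard2004HeegnerKolyvagin, Def. 2.1.10 (H¹_F = H¹_unr outside Σ(F))]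
[cite: GreenbergVatsal2000, §2 p. 17] -/
theorem eisensteinTowerReadout_resH1Hom_inertiaInToH_eq_zero_of_mem_unramifiedSubgroup (v : HeightOneSpectrum (𝓞 K))
    (k : ℕ)
    (c : galoisCohomology
      ((κ.unitTwist (-1)).eisensteinTwist ((W.baseChange K).torsionGaloisModule ((p : ℤ) ^ (k + 1))) hm (k + 1)) 1)
    (hc : galoisCohomology.localization
        ((κ.unitTwist (-1)).eisensteinTwist ((W.baseChange K).torsionGaloisModule ((p : ℤ) ^ (k + 1))) hm (k + 1))
        (Sum.inr v) 1 c ∈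
      DiscreteGaloisModule.unramifiedSubgroup (GaloisRep.toLocal v
        ((κ.unitTwist (-1)).eisensteinTwist ((W.baseChange K).torsionGaloisModule ((p : ℤ) ^ (k + 1))) hm (k + 1))) 1) :
    letI := IwasawaAlgebra.isLocalRing_quotient_X_pow_add_C p hm
    resH1Hom (inertiaInToH κ.kerSubgroup v) (AddMonoidHom.id ((W.baseChange K).geomPrimaryTorsion p)) (fun _ _ ↦ rfl)
      (W.eisensteinTowerReadout κ hm π e hkill hker hπ he hπX hek
        (AddCommGroup.DirectLimit.of _ _ k c :
          AdicTower.H1A (W.eisensteinTower (κ.unitTwist (-1)) hm) π e hkill hker hπ he)) = 0 := by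
  have h := (W.baseChange K).exists_cocycle_eq_coboundary_of_mem_unramifiedSubgroup κ hm v (k + 1) _ hc
  obtain ⟨ξ, rfl⟩ := oneCocycleClass_surjective _ c
  exact W.eisensteinTowerReadout_resH1Hom_inertiaInToH_eq_zero_of_exists κ hm π e hkill hker hπ he hπX hek v k ξ h

end WeierstrassCurve
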